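import Summits.CriticalPhenomena.Ising3DConformalLimit.Theorems.FKParityRobustnessFKFourConnectivityDefs
import Literature.Probability.LatticeModels.RandomClusterConditionalDomination
import Literature.Probability.LatticeModels.RandomClusterProofs
import Literature.Probability.LatticeModels.RandomClusterDomainMarkovFree
import Literature.Probability.Percolation.PercolationEvents

/-!
# Crux `FKFourConnectivity` (stmt-CriticalPhenomena-11254), line `cluster-hole-opacity`:
# the hole dictionary (stub `stub_holeDictionary`)

For a finite graph `G`, `β ≥ 0`, a vertex set `K` and vertices `y, y'`, the FK–Ising
(`q = 2`, `p = 1 - e^{-2β}`) probability that `y ↔ y'`, conditioned on the HOLE of `K`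
(no open edge touches `K`), is the free Ising two-point function `⟨σ_y σ_{y'}⟩` of the HOLED
graph `holedGraph G K` (every edge touching `K` deleted).

Proof (exact identity): the free random-cluster measure is supported on subsets of `E(G)`, on
which the hole of `K` is the cylinder event "every edge off `U` is closed" for
`U = {e ∈ E(G) | e ∩ K = ∅}`; the closed-outside domain Markov property
(`rcMeasure_real_inter_cylinder_empty_eq_mul_fromEdgeSet`, Grimmett 2006, Thm. (3.1)(a)) turns the
conditional probability into the free random-cluster probability of the spanning graph `⟨U⟩`,
which is `holedGraph G K`; the Edwards–Sokal identity on the holed graph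
(`edwardsSokal_twoPoint_holds`) finishes.
-/

noncomputable section

open MeasureTheory Finset
open Literature.Probability.LatticeModels Literature.Probability.Percolation

namespace Summit.CriticalPhenomena.Ising3DConformalLimit.Cruxes.FKFourConnectivity.ClusterHoleOpacity

open scoped Classical

section Helpers

variable {V : Type*} [Fintype V] [DecidableEq V]

/-- Transport of the random-cluster measure along an equality of graphs: the `DecidableRel`
instance argument is a subsingleton, so the measure only depends on the graph. [folklore] -/
theorem rcMeasure_congr_graph {H H' : SimpleGraph V} {i : DecidableRel H.Adj}
    {i' : DecidableRel H'.Adj} (h : H = H') (p q : ℝ) (B : Set V) :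
    @rcMeasure V _ _ H i p q B = @rcMeasure V _ _ H' i' p q B := by
  subst h
  cases Subsingleton.elim i i'
  rfl

/-- The spanning graph of the edges of `G` not touching `K` is the holed graph `holedGraph G K`.
[folklore] -/
theorem fromEdgeSet_filter_eq_holedGraph (G : SimpleGraph V) [DecidableRel G.Adj] (K : Set V) :
    SimpleGraph.fromEdgeSet (↑(G.edgeFinset.filter fun e => ∀ v ∈ K, v ∉ e) : Set (Sym2 V)) =
      holedGraph G K := by
  ext u v
  rw [show (holedGraph G K).Adj u v ↔ G.Adj u v ∧ u ∉ K ∧ v ∉ K from Iff.rfl,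
    SimpleGraph.fromEdgeSet_adj, Finset.coe_filter, Set.mem_setOf_eq, SimpleGraph.mem_edgeFinset,
    SimpleGraph.mem_edgeSet]
  constructor
  · rintro ⟨⟨hadj, hK⟩, -⟩
    exact ⟨hadj, fun hu => hK u hu (Sym2.mem_mk_left u v), fun hv => hK v hv (Sym2.mem_mk_right u v)⟩
  · rintro ⟨hadj, hu, hv⟩
    refine ⟨⟨hadj, fun w hw hmem => ?_⟩, hadj.ne⟩
    rcases Sym2.mem_iff.1 hmem with rfl | rfl
    exacts [hu hw, hv hw]

/-- Two events that agree on the support `{ω | ω ⊆ E(G)}` of the random-cluster measure have the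
same probability (the measure is a finite sum of Dirac masses at the subsets of `E(G)`).
[folklore] -/
theorem rcMeasure_real_congr_support (G : SimpleGraph V) [DecidableRel G.Adj] {p q : ℝ}
    (hp : p ∈ Set.Icc (0 : ℝ) 1) (hq : 0 < q) (B : Set V) {S S' : Set (BondConfig V)}
    (h : ∀ ω : Finset (Sym2 V), ω ⊆ G.edgeFinset →
      ((↑ω : BondConfig V) ∈ S ↔ (↑ω : BondConfig V) ∈ S')) :
    (rcMeasure G p q B).real S = (rcMeasure G p q B).real S' := by
  rw [rcMeasure_real_apply G hp hq B S, rcMeasure_real_apply G hp hq B S']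
  refine Finset.sum_congr rfl fun ω hω => ?_
  rw [Finset.mem_powerset] at hω
  by_cases hS : (↑ω : BondConfig V) ∈ S
  · rw [if_pos hS, if_pos ((h ω hω).1 hS)]
  · rw [if_neg hS, if_neg (fun hS' => hS ((h ω hω).2 hS'))]

/-- For `p < 1` the cylinder event "every edge off `U` is closed" has positive random-cluster
probability: the empty configuration alone has weight `(1 - p)^{|E|} q^{k(∅)} > 0`
(pattern of `rcMeasure_real_outerClosed_pos`). [folklore] -/
theorem rcMeasure_real_offClosed_pos (G : SimpleGraph V) [DecidableRel G.Adj] {p q : ℝ}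
    (hp : p ∈ Set.Ico (0 : ℝ) 1) (hq : 0 < q) (B : Set V) (U : Finset (Sym2 V)) :
    0 < (rcMeasure G p q B).real {ω | ω ∩ (↑U : Set (Sym2 V))ᶜ = ∅} := by
  have hp' : p ∈ Set.Icc (0 : ℝ) 1 := ⟨hp.1, hp.2.le⟩
  have hZ := rcPartitionFunction_pos G hp' hq B
  rw [rcMeasure_real_apply G hp' hq B]
  refine lt_of_lt_of_le ?_ (Finset.single_le_sum (fun ω _ => ?_) (Finset.empty_mem_powerset _))
  · rw [if_pos (by simp)]
    refine div_pos ?_ hZ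
    simp only [rcWeight, Finset.card_empty, pow_zero, one_mul, Finset.sdiff_empty]
    exact mul_pos (pow_pos (sub_pos.2 hp.2) _) (pow_pos hq _)
  · split_ifs
    · exact div_nonneg (rcWeight_nonneg _ hp' hq.le _ _) hZ.le
    · exact le_rfl

end Helpers

/-- **Hole dictionary** (registered stub `stub_holeDictionary` of the line `cluster-hole-opacity`,
crux `FKFourConnectivity`, stmt-CriticalPhenomena-11254): for a finite graph `G`, `β ≥ 0`, a vertex
set `K` and vertices `y, y'`, the free FK–Ising probability of `y ↔ y'` conditioned on the hole of
`K` equals the free Ising two-point function `⟨σ_y σ_{y'}⟩_{β}` of the holed graph `holedGraph G K`: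
`φ_{G,p,2}(y ↔ y' ∩ hole K) / φ_{G,p,2}(hole K) = ⟨σ_y σ_{y'}⟩^{free}_{holedGraph G K, β}`,
`p = 1 - e^{-2β}` (closed-outside domain Markov property, Grimmett 2006 Thm. (3.1)(a), and the
Edwards–Sokal identity, Grimmett 2006 Thm. 1.16, on the holed graph). -/
theorem stub_holeDictionary :
    ∀ (V : Type) [Fintype V] [DecidableEq V] (G : SimpleGraph V) [DecidableRel G.Adj] (β : ℝ),
      0 ≤ β → ∀ (K : Set V) (y y' : V),
        (rcMeasure G (fkIsingParam β) 2 ∅).real (openConn y y' ∩ hole K) /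
            (rcMeasure G (fkIsingParam β) 2 ∅).real (hole K) =
          isingTwoPoint (holedGraph G K) univ β 0 .free y y' := by
  intro V _ _ G _ β hβ K y y'
  have hp : fkIsingParam β ∈ Set.Icc (0 : ℝ) 1 := fkIsingParam_mem_Icc hβ
  have hp1 : fkIsingParam β < 1 := by
    have := Real.exp_pos (-2 * β)
    simp only [fkIsingParam]
    linarith
  have hq : (0 : ℝ) < 2 := two_pos
  -- the region: edges of `G` not touching `K`
  obtain ⟨U, hUdef⟩ : ∃ U : Finset (Sym2 V), U = G.edgeFinset.filter fun e => ∀ v ∈ K, v ∉ e :=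
    ⟨_, rfl⟩
  have hU : U ⊆ G.edgeFinset := hUdef ▸ Finset.filter_subset _ _
  have hGU : SimpleGraph.fromEdgeSet (↑U : Set (Sym2 V)) = holedGraph G K :=
    hUdef ▸ fromEdgeSet_filter_eq_holedGraph G K
  -- (i) on the support, the hole of `K` is the cylinder "every edge off `U` is closed"
  have hsupp : ∀ ω : Finset (Sym2 V), ω ⊆ G.edgeFinset →
      ((↑ω : BondConfig V) ∈ hole K ↔
        (↑ω : BondConfig V) ∈ {ω : BondConfig V | ω ∩ (↑U : Set (Sym2 V))ᶜ = ∅}) := by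
    intro ω hω
    rw [Set.mem_setOf_eq, ← Set.sdiff_eq, Set.sdiff_eq_empty, Finset.coe_subset,
      show ((↑ω : BondConfig V) ∈ hole K) ↔ ∀ e ∈ (↑ω : Set (Sym2 V)), ∀ v ∈ K, v ∉ e from Iff.rfl]
    constructor
    · intro h e he
      rw [hUdef, Finset.mem_filter]
      exact ⟨hω he, h e (Finset.mem_coe.2 he)⟩
    · intro h e he v hv
      have heU := h (Finset.mem_coe.1 he)
      rw [hUdef, Finset.mem_filter] at heU
      exact heU.2 v hv
  -- the conditioned event: on the cylinder, `ω ∩ U = ω`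
  have hev : openConn y y' ∩ {ω : BondConfig V | ω ∩ (↑U : Set (Sym2 V))ᶜ = ∅} =
      {ω : BondConfig V | ω ∩ ↑U ∈ openConn y y'} ∩
        {ω : BondConfig V | ω ∩ (↑U : Set (Sym2 V))ᶜ = ∅} := by
    ext ω
    simp only [Set.mem_inter_iff, Set.mem_setOf_eq]
    constructor
    · rintro ⟨h1, h2⟩
      have hωU : ω ∩ ↑U = ω := by
        rw [Set.inter_eq_left, ← Set.sdiff_eq_empty, Set.sdiff_eq]
        exact h2
      exact ⟨by rwa [hωU], h2⟩
    · rintro ⟨h1, h2⟩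
      have hωU : ω ∩ ↑U = ω := by
        rw [Set.inter_eq_left, ← Set.sdiff_eq_empty, Set.sdiff_eq]
        exact h2
      exact ⟨by rwa [hωU] at h1, h2⟩
  have hnum : (rcMeasure G (fkIsingParam β) 2 ∅).real (openConn y y' ∩ hole K) =
      (rcMeasure G (fkIsingParam β) 2 ∅).real
        ({ω : BondConfig V | ω ∩ ↑U ∈ openConn y y'} ∩
          {ω : BondConfig V | ω ∩ (↑U : Set (Sym2 V))ᶜ = ∅}) := by
    rw [← hev]
    exact rcMeasure_real_congr_support G hp hq ∅ fun ω hω => and_congr_right' (hsupp ω hω)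
  have hden : (rcMeasure G (fkIsingParam β) 2 ∅).real (hole K) =
      (rcMeasure G (fkIsingParam β) 2 ∅).real
        {ω : BondConfig V | ω ∩ (↑U : Set (Sym2 V))ᶜ = ∅} :=
    rcMeasure_real_congr_support G hp hq ∅ hsupp
  have hDpos : 0 < (rcMeasure G (fkIsingParam β) 2 ∅).real
      {ω : BondConfig V | ω ∩ (↑U : Set (Sym2 V))ᶜ = ∅} :=
    rcMeasure_real_offClosed_pos G ⟨hp.1, hp1⟩ hq ∅ U
  -- (ii)+(iii) closed-outside domain Markov property, then divide
  rw [hnum, hden,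
    rcMeasure_real_inter_cylinder_empty_eq_mul_fromEdgeSet G hp hq ∅ U hU (openConn y y'),
    mul_div_cancel_left₀ _ hDpos.ne']
  -- (iv)+(v) the spanning graph of `U` is the holed graph; Edwards–Sokal on it
  rw [edwardsSokal_twoPoint_holds (holedGraph G K) hβ y y']
  exact congrArg (fun μ : Measure (BondConfig V) => μ.real (openConn y y'))
    (rcMeasure_congr_graph hGU (fkIsingParam β) 2 ∅)

end Summit.CriticalPhenomena.Ising3DConformalLimit.Cruxes.FKFourConnectivity.ClusterHoleOpacity

end
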